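import Summits.Ventures.HodgeRepro.QuadF24

/-!
# Route-2's Theorem F in every ambient `(G, c)` containing `C₂ × A₄` through `c`

Blind re-derivation cell `pub-hodge-repro`, seat `p1` (gen 12).  `QuadF24.lean` decided one instance of route-2's
Theorem F (ROUTE-B §9.41) on the model `ℤ/2 × (V₄ ⋊ C₃)`.  Here the instance is transported to every finite
`(G, c)`: given `x ∈ G` of order 3 and two distinct commuting involutions `n₁, n₂ ≠ 1` with `x n₁ x⁻¹ = n₂`,
`x n₂ x⁻¹ = n₁ n₂` (so `⟨x, n₁, n₂⟩ ≅ A₄`) and the complex conjugation `c ∉ ⟨x, n₁, n₂⟩`, the hom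
`modelHomF : C2xA4 →* G`, `(e, ((a, b), r)) ↦ cᵉ n₁ᵃ n₂ᵇ xʳ` (`MonoidHom.noncommCoprod` of the power hom of `c` with the
`SemidirectProduct.lift` of the Klein hom `(a, b) ↦ n₁ᵃ n₂ᵇ` and the power hom of `x`), is injective
(`modelHomF_injective`), and gen 10's `exists_quad_of_pattern` with the decided pattern `ΦF` gives
`exists_FQuad`: a CM type of `(G, c)` whose twists by `Δ(x, n₁) = {1, x, c n₁, c x⁻¹ n₁ x²}` are `SumTwo` without a
conjugate pair.  The hypotheses are satisfied by the model itself (`QuadF24.lean`), so the theorem is non-vacuous.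
-/

set_option autoImplicit false

open Finset Multiplicative
open scoped Pointwise

namespace HodgeRepro.TheoremF

open HodgeRepro.CosetQuad

variable {G : Type*} [Group G]

/-! ### Values of the model's generators -/

/-- `phi3` on the generator is `sigma`. -/
theorem phi3_one : phi3 (ofAdd 1) = sigma := by
  rw [phi3, zmodPowHom_apply, toAdd_ofAdd]
  have h : (1 : ZMod 3).val = 1 := by decide
  rw [h, pow_one]

/-- `phi3` on `2` is `sigma²`. -/
theorem phi3_two : phi3 (ofAdd 2) = sigma ^ 2 := by
  rw [phi3, zmodPowHom_apply, toAdd_ofAdd]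
  have h : (2 : ZMod 3).val = 2 := by decide
  rw [h]

/-- `phi3` on `0` is the identity. -/
theorem phi3_zero : phi3 (ofAdd 0) = 1 := by
  rw [phi3, zmodPowHom_apply, toAdd_ofAdd, ZMod.val_zero, pow_zero]

/-! ### The Klein hom and the `A₄` hom -/

/-- The Klein hom `V₄ →* G`, `(a, b) ↦ n₁ᵃ n₂ᵇ`, for commuting involutions `n₁, n₂`. -/
def kleinHom (n₁ n₂ : G) (hn₁ : n₁ ^ 2 = 1) (hn₂ : n₂ ^ 2 = 1) (hcomm : n₁ * n₂ = n₂ * n₁) : V4 →* G :=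
  (zmodPowHom 2 n₁ hn₁).noncommCoprod (zmodPowHom 2 n₂ hn₂)
    (fun _ _ => Commute.pow_pow (hcomm : Commute n₁ n₂) _ _)

/-- `kleinHom (a, b) = n₁ᵃ n₂ᵇ`. -/
theorem kleinHom_apply (n₁ n₂ : G) (hn₁ : n₁ ^ 2 = 1) (hn₂ : n₂ ^ 2 = 1) (hcomm : n₁ * n₂ = n₂ * n₁)
    (a b : ZMod 2) : kleinHom n₁ n₂ hn₁ hn₂ hcomm (ofAdd a, ofAdd b) = n₁ ^ a.val * n₂ ^ b.val := by
  rw [kleinHom, MonoidHom.noncommCoprod_apply, zmodPowHom_apply, zmodPowHom_apply, toAdd_ofAdd, toAdd_ofAdd]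

/-- The four values of the Klein hom. -/
theorem kleinHom_values (n₁ n₂ : G) (hn₁ : n₁ ^ 2 = 1) (hn₂ : n₂ ^ 2 = 1) (hcomm : n₁ * n₂ = n₂ * n₁) :
    kleinHom n₁ n₂ hn₁ hn₂ hcomm (ofAdd 0, ofAdd 0) = 1 ∧
    kleinHom n₁ n₂ hn₁ hn₂ hcomm (ofAdd 1, ofAdd 0) = n₁ ∧
    kleinHom n₁ n₂ hn₁ hn₂ hcomm (ofAdd 0, ofAdd 1) = n₂ ∧
    kleinHom n₁ n₂ hn₁ hn₂ hcomm (ofAdd 1, ofAdd 1) = n₁ * n₂ := by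
  have h0 : (0 : ZMod 2).val = 0 := rfl
  have h1 : (1 : ZMod 2).val = 1 := rfl
  refine ⟨?_, ?_, ?_, ?_⟩ <;> rw [kleinHom_apply] <;> simp only [h0, h1, pow_zero, pow_one, one_mul, mul_one]

/-- The `A₄`-relations transported: `kleinHom ∘ sigma = conj x ∘ kleinHom` and `kleinHom ∘ sigma² = conj x² ∘ kleinHom`. -/
theorem klein_compat (x n₁ n₂ : G) (hn₁ : n₁ ^ 2 = 1) (hn₂ : n₂ ^ 2 = 1) (hcomm : n₁ * n₂ = n₂ * n₁)
    (hx₁ : x * n₁ * x⁻¹ = n₂) (hx₂ : x * n₂ * x⁻¹ = n₁ * n₂) (hx : x ^ 3 = 1) (r : Multiplicative (ZMod 3)) :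
    (kleinHom n₁ n₂ hn₁ hn₂ hcomm).comp (MulEquiv.toMonoidHom (phi3 r)) =
      (MulEquiv.toMonoidHom (MulAut.conj (zmodPowHom 3 x hx r))).comp (kleinHom n₁ n₂ hn₁ hn₂ hcomm) := by
  obtain ⟨k0, k1, k2, k3⟩ := kleinHom_values n₁ n₂ hn₁ hn₂ hcomm
  have hn₂' : n₂ * n₂ = 1 := by rw [← pow_two]; exact hn₂
  have hn₁' : n₁ * n₁ = 1 := by rw [← pow_two]; exact hn₁
  -- the conjugation by `x` of the three involutions
  have c1 : x * n₁ * x⁻¹ = n₂ := hx₁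
  have c2 : x * n₂ * x⁻¹ = n₁ * n₂ := hx₂
  have c3 : x * (n₁ * n₂) * x⁻¹ = n₁ := by
    have e : x * (n₁ * n₂) * x⁻¹ = (x * n₁ * x⁻¹) * (x * n₂ * x⁻¹) := by group
    rw [e, c1, c2, ← mul_assoc, ← hcomm, mul_assoc, hn₂', mul_one]
  -- and by `x²`
  have d1 : x ^ 2 * n₁ * (x ^ 2)⁻¹ = n₁ * n₂ := by
    have e : x ^ 2 * n₁ * (x ^ 2)⁻¹ = x * (x * n₁ * x⁻¹) * x⁻¹ := by
      rw [pow_two, mul_inv_rev]; simp only [mul_assoc]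
    rw [e, c1, c2]
  have d2 : x ^ 2 * n₂ * (x ^ 2)⁻¹ = n₁ := by
    have e : x ^ 2 * n₂ * (x ^ 2)⁻¹ = x * (x * n₂ * x⁻¹) * x⁻¹ := by
      rw [pow_two, mul_inv_rev]; simp only [mul_assoc]
    rw [e, c2, c3]
  have d3 : x ^ 2 * (n₁ * n₂) * (x ^ 2)⁻¹ = n₂ := by
    have e : x ^ 2 * (n₁ * n₂) * (x ^ 2)⁻¹ = x * (x * (n₁ * n₂) * x⁻¹) * x⁻¹ := by
      rw [pow_two, mul_inv_rev]; simp only [mul_assoc]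
    rw [e, c3, c1]
  obtain ⟨r, rfl⟩ := ofAdd.surjective r
  refine MonoidHom.ext (fun v => ?_)
  rw [MonoidHom.comp_apply, MonoidHom.comp_apply, MulEquiv.coe_toMonoidHom, MulEquiv.coe_toMonoidHom,
    MulAut.conj_apply, zmodPowHom_apply, toAdd_ofAdd]
  have hv : v = (ofAdd 0, ofAdd 0) ∨ v = (ofAdd 1, ofAdd 0) ∨ v = (ofAdd 0, ofAdd 1) ∨ v = (ofAdd 1, ofAdd 1) := by
    revert v; decide
  rcases (show r = 0 ∨ r = 1 ∨ r = 2 by revert r; decide) with rfl | rfl | rfl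
  · rw [phi3_zero, MulAut.one_apply, ZMod.val_zero, pow_zero, one_mul, inv_one, mul_one]
  · rw [phi3_one]
    have hval : (1 : ZMod 3).val = 1 := by decide
    rw [hval, pow_one]
    rcases hv with rfl | rfl | rfl | rfl
    · rw [show sigma (ofAdd 0, ofAdd 0) = (ofAdd 0, ofAdd 0) by decide, k0, mul_one, mul_inv_cancel]
    · rw [show sigma (ofAdd 1, ofAdd 0) = (ofAdd 0, ofAdd 1) by decide, k2, k1, c1]
    · rw [show sigma (ofAdd 0, ofAdd 1) = (ofAdd 1, ofAdd 1) by decide, k3, k2, c2]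
    · rw [show sigma (ofAdd 1, ofAdd 1) = (ofAdd 1, ofAdd 0) by decide, k1, k3, c3]
  · rw [phi3_two]
    have hval : (2 : ZMod 3).val = 2 := by decide
    rw [hval]
    rcases hv with rfl | rfl | rfl | rfl
    · rw [show (sigma ^ 2) (ofAdd 0, ofAdd 0) = (ofAdd 0, ofAdd 0) by decide, k0, mul_one, mul_inv_cancel]
    · rw [show (sigma ^ 2) (ofAdd 1, ofAdd 0) = (ofAdd 1, ofAdd 1) by decide, k3, k1, d1]
    · rw [show (sigma ^ 2) (ofAdd 0, ofAdd 1) = (ofAdd 1, ofAdd 0) by decide, k1, k2, d2]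
    · rw [show (sigma ^ 2) (ofAdd 1, ofAdd 1) = (ofAdd 0, ofAdd 1) by decide, k2, k3, d3]

/-- The `A₄` hom `A4 →* G`, `((a, b), r) ↦ n₁ᵃ n₂ᵇ xʳ`. -/
def a4Hom (x n₁ n₂ : G) (hn₁ : n₁ ^ 2 = 1) (hn₂ : n₂ ^ 2 = 1) (hcomm : n₁ * n₂ = n₂ * n₁)
    (hx₁ : x * n₁ * x⁻¹ = n₂) (hx₂ : x * n₂ * x⁻¹ = n₁ * n₂) (hx : x ^ 3 = 1) : A4 →* G :=
  SemidirectProduct.lift (kleinHom n₁ n₂ hn₁ hn₂ hcomm) (zmodPowHom 3 x hx)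
    (klein_compat x n₁ n₂ hn₁ hn₂ hcomm hx₁ hx₂ hx)

/-- `a4Hom ⟨v, r⟩ = kleinHom v * xʳ`. -/
theorem a4Hom_mk (x n₁ n₂ : G) (hn₁ : n₁ ^ 2 = 1) (hn₂ : n₂ ^ 2 = 1) (hcomm : n₁ * n₂ = n₂ * n₁)
    (hx₁ : x * n₁ * x⁻¹ = n₂) (hx₂ : x * n₂ * x⁻¹ = n₁ * n₂) (hx : x ^ 3 = 1) (v : V4)
    (r : Multiplicative (ZMod 3)) :
    a4Hom x n₁ n₂ hn₁ hn₂ hcomm hx₁ hx₂ hx ⟨v, r⟩ = kleinHom n₁ n₂ hn₁ hn₂ hcomm v * x ^ (toAdd r).val := by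
  rw [SemidirectProduct.mk_eq_inl_mul_inr, map_mul, a4Hom, SemidirectProduct.lift_inl,
    SemidirectProduct.lift_inr, zmodPowHom_apply]

/-- The model hom `C2xA4 →* G`, `(e, a) ↦ cᵉ · a4Hom a`, for a central `c`. -/
def modelHomF {c : G} (hc : IsComplexConj c) (x n₁ n₂ : G) (hn₁ : n₁ ^ 2 = 1) (hn₂ : n₂ ^ 2 = 1)
    (hcomm : n₁ * n₂ = n₂ * n₁) (hx₁ : x * n₁ * x⁻¹ = n₂) (hx₂ : x * n₂ * x⁻¹ = n₁ * n₂) (hx : x ^ 3 = 1) :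
    C2xA4 →* G :=
  (zmodPowHom 2 c (conj_sq_eq_one hc)).noncommCoprod (a4Hom x n₁ n₂ hn₁ hn₂ hcomm hx₁ hx₂ hx)
    (fun _ _ => Commute.pow_left (hc.comm _) _)

/-- `modelHomF (e, a) = cᵉ · a4Hom a`. -/
theorem modelHomF_apply {c : G} (hc : IsComplexConj c) (x n₁ n₂ : G) (hn₁ : n₁ ^ 2 = 1) (hn₂ : n₂ ^ 2 = 1)
    (hcomm : n₁ * n₂ = n₂ * n₁) (hx₁ : x * n₁ * x⁻¹ = n₂) (hx₂ : x * n₂ * x⁻¹ = n₁ * n₂) (hx : x ^ 3 = 1)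
    (e : Multiplicative (ZMod 2)) (a : A4) :
    modelHomF hc x n₁ n₂ hn₁ hn₂ hcomm hx₁ hx₂ hx (e, a) =
      c ^ (toAdd e).val * a4Hom x n₁ n₂ hn₁ hn₂ hcomm hx₁ hx₂ hx a := by
  rw [modelHomF, MonoidHom.noncommCoprod_apply, zmodPowHom_apply]

/-- The images of the generators: `c ↦ c`, `x ↦ x`, `n₁ ↦ n₁`. -/
theorem modelHomF_generators {c : G} (hc : IsComplexConj c) (x n₁ n₂ : G) (hn₁ : n₁ ^ 2 = 1) (hn₂ : n₂ ^ 2 = 1)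
    (hcomm : n₁ * n₂ = n₂ * n₁) (hx₁ : x * n₁ * x⁻¹ = n₂) (hx₂ : x * n₂ * x⁻¹ = n₁ * n₂) (hx : x ^ 3 = 1) :
    modelHomF hc x n₁ n₂ hn₁ hn₂ hcomm hx₁ hx₂ hx cF = c ∧
    modelHomF hc x n₁ n₂ hn₁ hn₂ hcomm hx₁ hx₂ hx xF = x ∧
    modelHomF hc x n₁ n₂ hn₁ hn₂ hcomm hx₁ hx₂ hx n1F = n₁ := by
  obtain ⟨k0, k1, _, _⟩ := kleinHom_values n₁ n₂ hn₁ hn₂ hcomm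
  have h2 : (1 : ZMod 2).val = 1 := rfl
  have h3 : (1 : ZMod 3).val = 1 := by decide
  refine ⟨?_, ?_, ?_⟩
  · rw [cF, modelHomF_apply, toAdd_ofAdd, h2, pow_one, map_one, mul_one]
  · rw [xF, modelHomF_apply, show (1 : Multiplicative (ZMod 2)) = ofAdd 0 from rfl, toAdd_ofAdd, ZMod.val_zero,
      pow_zero, one_mul, a4Hom, SemidirectProduct.lift_inr, zmodPowHom_apply, toAdd_ofAdd, h3, pow_one]
  · rw [n1F, modelHomF_apply, show (1 : Multiplicative (ZMod 2)) = ofAdd 0 from rfl, toAdd_ofAdd, ZMod.val_zero,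
      pow_zero, one_mul, a4Hom, SemidirectProduct.lift_inl, k1]

/-- The twists: `modelHomF (tF i) = ![1, x, c n₁, c x⁻¹ n₁ x²] i`. -/
theorem modelHomF_tF {c : G} (hc : IsComplexConj c) (x n₁ n₂ : G) (hn₁ : n₁ ^ 2 = 1) (hn₂ : n₂ ^ 2 = 1)
    (hcomm : n₁ * n₂ = n₂ * n₁) (hx₁ : x * n₁ * x⁻¹ = n₂) (hx₂ : x * n₂ * x⁻¹ = n₁ * n₂) (hx : x ^ 3 = 1)
    (i : Fin 4) :
    modelHomF hc x n₁ n₂ hn₁ hn₂ hcomm hx₁ hx₂ hx (tF i) = ![1, x, c * n₁, c * x⁻¹ * n₁ * x ^ 2] i := by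
  obtain ⟨gc, gx, gn⟩ := modelHomF_generators hc x n₁ n₂ hn₁ hn₂ hcomm hx₁ hx₂ hx
  fin_cases i
  · exact map_one _
  · exact gx
  · show modelHomF hc x n₁ n₂ hn₁ hn₂ hcomm hx₁ hx₂ hx (cF * n1F) = c * n₁
    rw [map_mul, gc, gn]
  · show modelHomF hc x n₁ n₂ hn₁ hn₂ hcomm hx₁ hx₂ hx (cF * xF⁻¹ * n1F * xF ^ 2) = c * x⁻¹ * n₁ * x ^ 2
    rw [map_mul, map_mul, map_mul, map_inv, map_pow, gc, gx, gn]

/-! ### Injectivity -/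

/-- Every value of `a4Hom` lies in `⟨x, n₁, n₂⟩`. -/
theorem a4Hom_mem_closure (x n₁ n₂ : G) (hn₁ : n₁ ^ 2 = 1) (hn₂ : n₂ ^ 2 = 1) (hcomm : n₁ * n₂ = n₂ * n₁)
    (hx₁ : x * n₁ * x⁻¹ = n₂) (hx₂ : x * n₂ * x⁻¹ = n₁ * n₂) (hx : x ^ 3 = 1) (a : A4) :
    a4Hom x n₁ n₂ hn₁ hn₂ hcomm hx₁ hx₂ hx a ∈ Subgroup.closure ({x, n₁, n₂} : Set G) := by
  obtain ⟨⟨a', b'⟩, r⟩ := a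
  obtain ⟨a, rfl⟩ := ofAdd.surjective a'
  obtain ⟨b, rfl⟩ := ofAdd.surjective b'
  rw [a4Hom_mk, kleinHom_apply]
  have hx' : x ∈ Subgroup.closure ({x, n₁, n₂} : Set G) := Subgroup.subset_closure (by simp)
  have hn₁' : n₁ ∈ Subgroup.closure ({x, n₁, n₂} : Set G) := Subgroup.subset_closure (by simp)
  have hn₂' : n₂ ∈ Subgroup.closure ({x, n₁, n₂} : Set G) := Subgroup.subset_closure (by simp)
  exact Subgroup.mul_mem _ (Subgroup.mul_mem _ (Subgroup.pow_mem _ hn₁' _) (Subgroup.pow_mem _ hn₂' _))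
    (Subgroup.pow_mem _ hx' _)

/-- `modelHomF` is injective when `x` has order `3`, `n₁, n₂` are distinct non-trivial, and `c ∉ ⟨x, n₁, n₂⟩`. -/
theorem modelHomF_injective {c : G} (hc : IsComplexConj c) (x n₁ n₂ : G) (hn₁ : n₁ ^ 2 = 1) (hn₂ : n₂ ^ 2 = 1)
    (hcomm : n₁ * n₂ = n₂ * n₁) (hx₁ : x * n₁ * x⁻¹ = n₂) (hx₂ : x * n₂ * x⁻¹ = n₁ * n₂) (hx : x ^ 3 = 1)
    (hx3 : orderOf x = 3) (hn₁1 : n₁ ≠ 1) (hn₂1 : n₂ ≠ 1) (hne : n₁ ≠ n₂)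
    (hcA : c ∉ Subgroup.closure ({x, n₁, n₂} : Set G)) :
    Function.Injective (modelHomF hc x n₁ n₂ hn₁ hn₂ hcomm hx₁ hx₂ hx) := by
  obtain ⟨k0, k1, k2, k3⟩ := kleinHom_values n₁ n₂ hn₁ hn₂ hcomm
  have hV2 : ∀ v : V4, v ^ 2 = 1 := by decide
  have hV4 : ∀ v : V4, v = (ofAdd 0, ofAdd 0) ∨ v = (ofAdd 1, ofAdd 0) ∨ v = (ofAdd 0, ofAdd 1) ∨
      v = (ofAdd 1, ofAdd 1) := by decide
  rw [injective_iff_map_eq_one]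
  rintro ⟨e, ⟨v, r⟩⟩ h
  rw [modelHomF_apply] at h
  obtain ⟨e, rfl⟩ := ofAdd.surjective e
  rcases (show ∀ y : ZMod 2, y = 0 ∨ y = 1 by decide) e with rfl | rfl
  · -- `e = 0`: `a4Hom ⟨v, r⟩ = 1`
    rw [toAdd_ofAdd, ZMod.val_zero, pow_zero, one_mul, a4Hom_mk] at h
    -- square: the Klein part squares to `1`, so `x ^ (2 r) = 1` and `r = 0`
    have hv2 : kleinHom n₁ n₂ hn₁ hn₂ hcomm v ^ 2 = 1 := by
      rw [← map_pow, hV2 v, map_one]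
    have hr : x ^ (2 * (toAdd r).val) = 1 := by
      have e1 : x ^ (toAdd r).val = (kleinHom n₁ n₂ hn₁ hn₂ hcomm v)⁻¹ := eq_inv_of_mul_eq_one_right h
      rw [mul_comm, pow_mul, e1, inv_pow, hv2, inv_one]
    have hdvd : 3 ∣ 2 * (toAdd r).val := by
      have := orderOf_dvd_of_pow_eq_one hr; rwa [hx3] at this
    have hr0 : (toAdd r).val = 0 := by
      rcases (Nat.prime_three.dvd_mul).mp hdvd with h3 | h3
      · omega
      · exact Nat.eq_zero_of_dvd_of_lt h3 (ZMod.val_lt _)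
    rw [hr0, pow_zero, mul_one] at h
    have hr1 : r = 1 := by
      rw [← ofAdd_toAdd r, (ZMod.val_eq_zero _).mp hr0, ofAdd_zero]
    have hv1 : v = 1 := by
      rcases hV4 v with rfl | rfl | rfl | rfl
      · rfl
      · exact absurd (k1 ▸ h) hn₁1
      · exact absurd (k2 ▸ h) hn₂1
      · exfalso
        rw [k3] at h
        exact hne (by rw [eq_inv_of_mul_eq_one_left h, inv_eq_of_mul_eq_one_right (by rw [← pow_two]; exact hn₂)])
    rw [hv1, hr1]
    rfl
  · -- `e = 1`: `c ∈ ⟨x, n₁, n₂⟩`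
    exfalso
    rw [toAdd_ofAdd, val_one_two, pow_one] at h
    apply hcA
    rw [eq_inv_of_mul_eq_one_left h]
    exact Subgroup.inv_mem _ (a4Hom_mem_closure x n₁ n₂ hn₁ hn₂ hcomm hx₁ hx₂ hx _)

/-! ### The theorem -/

/-- **Theorem F in every ambient group (route-2 §9.41, kernel existence).**  For every finite `(G, c)`, `x ∈ G` of
order `3`, distinct commuting involutions `n₁, n₂ ≠ 1` with `x n₁ x⁻¹ = n₂`, `x n₂ x⁻¹ = n₁ n₂` (an `A₄` through
`x, n₁, n₂`) and `c ∉ ⟨x, n₁, n₂⟩`: some CM type has its twists by `Δ(x, n₁) = {1, x, c n₁, c x⁻¹ n₁ x²}` `SumTwo`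
without a conjugate pair. -/
theorem exists_FQuad [Fintype G] [DecidableEq G] {c : G} (hc : IsComplexConj c) (x n₁ n₂ : G)
    (hx3 : orderOf x = 3) (hn₁ : n₁ ^ 2 = 1) (hn₂ : n₂ ^ 2 = 1) (hcomm : n₁ * n₂ = n₂ * n₁)
    (hx₁ : x * n₁ * x⁻¹ = n₂) (hx₂ : x * n₂ * x⁻¹ = n₁ * n₂) (hn₁1 : n₁ ≠ 1) (hn₂1 : n₂ ≠ 1) (hne : n₁ ≠ n₂)
    (hcA : c ∉ Subgroup.closure ({x, n₁, n₂} : Set G)) :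
    ∃ Φ : Finset G, IsCMType c Φ ∧ SumTwo (fun i => rmul Φ (![1, x, c * n₁, c * x⁻¹ * n₁ * x ^ 2] i)) ∧
      ∀ i j : Fin 4, rmul Φ (![1, x, c * n₁, c * x⁻¹ * n₁ * x ^ 2] j) ≠
        c • rmul Φ (![1, x, c * n₁, c * x⁻¹ * n₁ * x ^ 2] i) := by
  have hx : x ^ 3 = 1 := by rw [← hx3]; exact pow_orderOf_eq_one x
  have hψ := modelHomF_injective hc x n₁ n₂ hn₁ hn₂ hcomm hx₁ hx₂ hx hx3 hn₁1 hn₂1 hne hcA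
  have hcard : Fintype.card (Fin 1) * Fintype.card C2xA4 ≤ Fintype.card G := by
    rw [Fintype.card_fin, one_mul]
    exact Fintype.card_le_of_injective _ hψ
  have h1 : ∀ p : C2xA4, decide (p * cF ∈ ΦF) = !decide (p ∈ ΦF) := by decide
  have h2 : ∀ p : C2xA4, (univ.filter fun i : Fin 4 => decide (p * (tF i)⁻¹ ∈ ΦF) = true).card = 2 := by
    decide
  have h3 : ∀ i j : Fin 4, ¬ ∀ p : C2xA4,
      (decide (p * (tF j)⁻¹ ∈ ΦF) = true ↔ decide (p * (cF * (tF i)⁻¹) ∈ ΦF) = true) := by decide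
  obtain ⟨Φ, g1, g2, g3⟩ := exists_quad_of_pattern (modelHomF hc x n₁ n₂ hn₁ hn₂ hcomm hx₁ hx₂ hx) hψ hc
    (modelHomF_generators hc x n₁ n₂ hn₁ hn₂ hcomm hx₁ hx₂ hx).1 tF (fun (_ : Fin 1) p => decide (p ∈ ΦF))
    (fun _ p => h1 p) (fun _ p => h2 p) (fun i j h => h3 i j (fun p => h 0 p)) hcard
  simp only [modelHomF_tF hc x n₁ n₂ hn₁ hn₂ hcomm hx₁ hx₂ hx] at g2 g3
  exact ⟨Φ, g1, g2, g3⟩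

end HodgeRepro.TheoremF
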